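import Literature.MathematicalPhysics.QuantumFieldTheory.Balaban1983to89.B11Eq80Current

/-!
# `Balaban1983to89.B11Eq80CurrentRealSubspace` — T. Bałaban, *The variational problem and background fields in renormalization group method for lattice gauge theories*, Commun. Math. Phys. **102** (1985) 277–309 [Balaban1985Variational]: (51) p. 286 «for A′ with values in 𝔤 the configuration D(A′) has values in 𝔤 also» — READ FOR THE PIECES `W₁`, `W₂`, `W₃` OF THE CURRENT `W(A′) = (δ/δA′)V(A′)` OF (84)–(89) (`B11Eq80Current.W1`/`W2`/`W3`/`W80`): a REAL-SUBSPACE CALCULUS on the carriers of (115) and the rows «`W_i(A′)` takes values in the real sector whenever `A′` does», IN HYPOTHESIS FORM over the letters `H`, `C`, `J`, `Δ_π`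

statement-level skeleton of published theorems with citation tags; proofs where landed; nothing here is a claim about the Yang–Mills mass gap

WHY.  The EX knit of record of cell `ym3-torus` displays the row (R-W) «`(δ∕δA′)V(U₀)` maps Hermitian-traceless (115)-fields of its ball to Hermitian-traceless
(−3)-data» on the OPAQUE letter `Wf`; the concrete letter is `B11Eq80Current.W80 ρ τ U₀ H C ε_C J Δπ = W1 + W2 + W3 + curV0full`.  Print's mechanism ((51) p. 286;
[Balaban1985BackgroundPropagators] p. 393 «The operators … are real»): every letter maps `𝔤`-valued data to `𝔤`-valued data, hence so do composites, Fréchet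
derivatives at `𝔤`-valued points, and transposes for the pairing (27).  Typed ONCE for a finite-dimensional fibre algebra `𝔸`, a real sector `S ⊆ 𝔸` (an
`ℝ`-submodule; for `SU(2)` the Hermitian traceless matrices) and — where transposes need it — the SCALAR sector `Z ⊆ 𝔸` (for `SU(2)`: `ℂ·1`).
WHAT IS PROVED (sorry-free; no definition).  §1 GENERIC CALCULUS (complex normed `E`, `F`; `ℝ`-submodules `V`, closed `V′`): `hasFDerivAt_apply_mem_of_sub_mem`
(TRANSLATE FORM: `f(x + w) − f(x) ∈ V′` for small `w ∈ V` ⟹ `f′(x)(V) ⊆ V′` — gives the sector row at a point `x ∈ V` of a map sending `V ∩ ball` into `V′`,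
`fderiv_apply_mem_of_mapsTo_of_mem`, and equally a scalar-sector row from central-affine behaviour; the `x = 0` case is cell `ym3-torus`'s Summits-side
`Prop7ChartRealityTwS.fderiv_apply_mem_of_mapsTo_of_ball`, which a Literature module cannot import); `iteratedFDeriv_two_apply_mem_of_mapsTo` (SECOND ORDER:
`D²f(0)(v,v) ∈ V′` for `v ∈ V` — print's `C^{(2)}(A′)` of (56)/(78)).  §2 CARRIERS + TRANSPOSE: `fderiv_apply_mem_of_analyticOnNhd` (§1 on the space (115), pointwise
form); ★★`transCur_apply_mem` — `Mᵗ` (`B11Eq90Transpose.transCur ρ τ M`) maps `S`-valued currents to `S`-valued currents when `M` maps `S`-valued fields to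
`S`-valued AND `Z`-valued fields to `Z`-valued fields, under the duality rows `τ(XY) ∈ ℝ` (`X, Y ∈ S`), `τ(Xz) = 0` (`X ∈ S`, `z ∈ Z`), `ρ(ℓ) ∈ S` for `ℓ` real on
`S` and zero on `Z`; the `Z`-row cannot be dropped (on `ℂ²`, `S = ℝ²`: `M = [[1,1],[0,0]]`).  §3 THE CHART `HD(·) = B11Eq80Current.Emap` of (47): ★★`Emap_apply_mem`
(Sect. C regime: `C` maps `S`-valued fields of its ball to `S_𝒳`, `H` maps `S_𝒳` to `S`-valued fields ⟹ `HD(A′)` is `S`-valued for `S`-valued `A′` — the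
contraction (52) runs inside the closed sector, lit ✓`B11Prop6Scheme.solution_mem_of_invariant`), `fderiv_Emap_apply_mem`, `quadPart_mem`, `E3_apply_mem`,
`fderiv_E3_apply_mem` (the same for `(HD)′(A′)`, `C^{(2)}`, `HD₃ = HD − HC^{(2)}`, `(HD₃)′(A′)`).  §4 THE ROWS IN HYPOTHESIS FORM: ★`W3_apply_mem`, ★`W2_apply_mem`,
★`W1_apply_mem`, ★★`W80_apply_mem` — for `S`-valued `A′`, `‖A′‖ < a_C`, `W_i(A′)` is `S`-valued GIVEN the named letter rows `hC`/`hH` (sector rows of `C`, `H`), `hJ`,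
`hΔπ`, the duality rows `hτS hτZ hρ`, the SCALAR-SECTOR rows `hDZ`/`hD3Z` of `(HD)′(A′)`, `(HD₃)′(A′)` («central directions stay central» — centre-equivariance
of the averaging (44), displayed, not derived here) and, for `W80`, the row `hV0` of the composed V₀-group current `curV0full` (`B11Eq90V0GroupComposed`, its own storey).
HONEST SCOPE.  Linear-algebra∕calculus bookkeeping; the letter rows are DISPLAYED hypotheses (for `SU(2)` at the lattice of record they belong to the layer that
instantiates `H`, `C`, `J`, `Δ_π`, `ρ`, `τ`); nothing of [Balaban1985Variational] Props 3–4 or of [Balaban1985BackgroundPropagators] is asserted.  Cell `ym-inputs`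
(seat p07 g5, desk word 2026-08-28); imports `B11Eq80Current` ONLY; modifies nothing.

References: T. Bałaban, CMP **102** (1985) 277–309 [Balaban1985Variational] ((27) p.282, (44)–(51) pp.285–286, (56) p.286, (78)–(80) p.290, (84)–(89)
pp.290–291, (115) p.294); CMP **99** (1985) 389–434 [Balaban1985BackgroundPropagators] (p.393, (3.14)).
-/

noncomputable section

open NormedSpace Complex Metric Set Finset Filter
open scoped Topology

namespace Literature.MathematicalPhysics.QuantumFieldTheory.Balaban1983to89.B11Eq80CurrentRealSubspace

open Literature.MathematicalPhysics.QuantumFieldTheory.Balaban1983to89.B11Prop6Scheme (Prop4Hyp mapT mapT_noLinear solution_mem_of_invariant)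
open Literature.MathematicalPhysics.QuantumFieldTheory.Balaban1983to89.B11Eq174Chart (solA Regime)
open Literature.MathematicalPhysics.QuantumFieldTheory.Balaban1983to89.B11Eq90V0primeCurrent (flat115 flat115_apply)
open Literature.MathematicalPhysics.QuantumFieldTheory.Balaban1983to89.B11Eq90Transpose
open Literature.MathematicalPhysics.QuantumFieldTheory.Balaban1983to89.B11Eq90V0GroupComposed (curV0full)
open Literature.MathematicalPhysics.QuantumFieldTheory.Balaban1983to89.B11Eq80Current
open B9SectCLatticeCarrier (Bond)
open B11Eq115Space

/-! ## §1 Generic calculus: derivatives of sector-preserving maps preserve the sector -/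

section Generic

variable {E F : Type*} [NormedAddCommGroup E] [NormedSpace ℂ E] [NormedAddCommGroup F] [NormedSpace ℂ F]

/-- ★ **TRANSLATE FORM OF THE FIRST-ORDER SECTOR ROW**: if `f` has derivative `f′` at `x` and `f(x + w) − f(x)` lies in the closed real subspace `V′`
for every `w` of the real subspace `V` with `‖w‖ < ρ`, then `f′` maps `V` into `V′` (the slopes `t⁻¹(f(x + tv) − f(x))`, `t → 0`, lie in `V′`).
[cite: Balaban1985Variational, (51) p.286] -/
theorem hasFDerivAt_apply_mem_of_sub_mem {f : E → F} {f' : E →L[ℂ] F} {x : E} (hf : HasFDerivAt f f' x)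
    (V : Submodule ℝ E) (V' : Submodule ℝ F) (hV' : IsClosed (V' : Set F)) {ρ : ℝ} (hρ : 0 < ρ)
    (hmaps : ∀ w ∈ V, ‖w‖ < ρ → f (x + w) - f x ∈ V') {v : E} (hv : v ∈ V) :
    f' v ∈ V' := by
  -- the line `t ↦ f (x + t • v)` has derivative `f′ v` at `0`
  have hℓ : HasDerivAt (fun t : ℝ => x + t • v) v 0 := by
    simpa using ((hasDerivAt_id (0:ℝ)).smul_const v).const_add x
  have hf'' : HasFDerivAt f (f'.restrictScalars ℝ) ((fun t : ℝ => x + t • v) 0) := by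
    simp only [zero_smul, add_zero]; exact hf.restrictScalars ℝ
  have hg : HasDerivAt (fun t : ℝ => f (x + t • v)) (f' v) 0 := by
    have h : HasDerivAt (f ∘ fun t : ℝ => x + t • v) ((f'.restrictScalars ℝ) v) 0 := hf''.comp_hasDerivAt (0:ℝ) hℓ
    exact h
  -- its slopes at small `t ≠ 0` lie in `V′`
  refine hV'.mem_of_tendsto hg.tendsto_slope_zero ?_
  have hsmall : ∀ᶠ t : ℝ in 𝓝[≠] 0, ‖t • v‖ < ρ := by
    have hcont : Tendsto (fun t : ℝ => ‖t • v‖) (𝓝 0) (𝓝 0) := by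
      simpa using ((continuous_id.smul continuous_const).norm : Continuous fun t : ℝ => ‖t • v‖).tendsto 0
    exact eventually_nhdsWithin_of_eventually_nhds (hcont.eventually (gt_mem_nhds hρ))
  filter_upwards [hsmall] with t ht
  have h1 : f (x + ((0:ℝ) + t) • v) - f (x + (0:ℝ) • v) ∈ V' := by
    rw [zero_add, zero_smul, add_zero]; exact hmaps _ (V.smul_mem _ hv) ht
  exact V'.smul_mem _ h1

/-- ★ **THE FIRST-ORDER SECTOR ROW AT A POINT OF THE SECTOR**: if `f` maps `V ∩ B(0, ρ)` into the closed `V′` and is differentiable at `x ∈ V`,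
`‖x‖ < ρ`, then `f′(x)` maps `V` into `V′`.  (At `x = 0` this is cell `ym3-torus`'s `Prop7ChartRealityTwS.fderiv_apply_mem_of_mapsTo_of_ball`.)
[cite: Balaban1985Variational, (51) p.286] -/
theorem fderiv_apply_mem_of_mapsTo_of_mem {f : E → F} {f' : E →L[ℂ] F} {x : E} (hf : HasFDerivAt f f' x)
    (V : Submodule ℝ E) (V' : Submodule ℝ F) (hV' : IsClosed (V' : Set F)) {ρ : ℝ}
    (hmaps : ∀ y ∈ V, ‖y‖ < ρ → f y ∈ V') (hx : x ∈ V) (hxρ : ‖x‖ < ρ) {v : E} (hv : v ∈ V) :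
    f' v ∈ V' := by
  refine hasFDerivAt_apply_mem_of_sub_mem hf V V' hV' (sub_pos.2 hxρ) (fun w hw hwρ => ?_) hv
  refine V'.sub_mem (hmaps _ (V.add_mem hx hw) ?_) (hmaps _ hx hxρ)
  calc ‖x + w‖ ≤ ‖x‖ + ‖w‖ := norm_add_le _ _
    _ < ‖x‖ + (ρ - ‖x‖) := by gcongr
    _ = ρ := by ring

/-- ★ **THE SECOND-ORDER DIAGONAL SECTOR ROW**: if `f` maps `V ∩ B(0, ρ)` into the closed `V′`, is differentiable on `B(0, ρ)` and its derivative
is differentiable at `0`, then `D²f(0)(v, v) ∈ V′` for every `v ∈ V` — print's second-order term `C^{(2)}(A′)` ((56), (78)) is `𝔤`-valued for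
`𝔤`-valued `A′`.  (Twice §1's first-order row: `y ↦ f′(y)v` maps `V ∩ B(0,ρ)` into `V′`, then differentiate at `0` along `v`.)
[cite: Balaban1985Variational, (51) p.286, (56) p.286, (78) p.290] -/
theorem iteratedFDeriv_two_apply_mem_of_mapsTo {f : E → F} (V : Submodule ℝ E) (V' : Submodule ℝ F) (hV' : IsClosed (V' : Set F))
    {ρ : ℝ} (hρ : 0 < ρ) (hmaps : ∀ y ∈ V, ‖y‖ < ρ → f y ∈ V') (hdiff : ∀ y, ‖y‖ < ρ → DifferentiableAt ℂ f y)
    (hdiff2 : DifferentiableAt ℂ (fderiv ℂ f) 0) {v : E} (hv : v ∈ V) :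
    iteratedFDeriv ℂ 2 f 0 (fun _ => v) ∈ V' := by
  -- `D²f(0)(v,v) = (d/dy)|₀ (f′(y) v) · v`
  have hrepr : iteratedFDeriv ℂ 2 f 0 (fun _ => v) = fderiv ℂ (fun y => fderiv ℂ f y v) 0 v := by
    rw [iteratedFDeriv_two_apply, fderiv_clm_apply hdiff2 (differentiableAt_const v)]
    simp
  rw [hrepr]
  -- the map `y ↦ f′(y) v` sends `V ∩ B(0,ρ)` into `V′` (first-order row at each point) and is differentiable at `0`
  have hG : HasFDerivAt (fun y => fderiv ℂ f y v) (fderiv ℂ (fun y => fderiv ℂ f y v) 0) 0 :=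
    ((hdiff2.clm_apply (differentiableAt_const v)).hasFDerivAt)
  refine fderiv_apply_mem_of_mapsTo_of_mem hG V V' hV' (ρ := ρ) (fun y hy hyρ => ?_) V.zero_mem (by simpa using hρ) hv
  exact fderiv_apply_mem_of_mapsTo_of_mem (hdiff y hyρ).hasFDerivAt V V' hV' hmaps hy hyρ hv

end Generic

/-! ## §2 The transpose for the pairing (27) preserves the sector — with the scalar sector explicit -/

section Carriers

variable {𝔸 : Type*} [NormedRing 𝔸] [NormedAlgebra ℂ 𝔸]
variable {d : ℕ} {Pd : Fin d → ℕ} {L η : ℝ} [Fact (0 < L)] [Fact (0 < η)] {lev₀ : Bond d Pd → ℕ} {κ' : Type*} [Fintype κ']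
  {lev₁ : κ' → ℕ} {Dc : (Bond d Pd → 𝔸) →ₗ[ℂ] (κ' → 𝔸)}

/-- The one-bond configuration `δ_b X` is `S`-valued when `X ∈ S` (its values are `X` and `0`). [cite: Balaban1985Variational, (90) p.291] -/
theorem equiv_single115_mem [FiniteDimensional ℂ 𝔸] (S : Submodule ℝ 𝔸) (b : Bond d Pd) {X : 𝔸} (hX : X ∈ S) (b' : Bond d Pd) :
    JetSup.equiv _ _ _ (single115 (L := L) (η := η) (lev₀ := lev₀) (lev₁ := lev₁) (Dc := Dc) b X) b' ∈ S := by
  change flat115 (single115 (L := L) (η := η) (lev₀ := lev₀) (lev₁ := lev₁) (Dc := Dc) b X) b' ∈ S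
  rw [flat115_single115]
  by_cases h : b' = b
  · subst h; rwa [Pi.single_eq_same]
  · rw [Pi.single_eq_of_ne h]; exact S.zero_mem

/-- ★★ **THE TRANSPOSE `Mᵗ` FOR THE PAIRING (27) MAPS `S`-VALUED CURRENTS TO `S`-VALUED CURRENTS** when `M` maps `S`-valued fields to `S`-valued fields
AND `Z`-valued (scalar) fields to `Z`-valued fields — given the duality rows of `(ρ, τ)`: `τ(XY)` real for `X, Y ∈ S` (`hτS`), `τ(Xz) = 0` for `X ∈ S`, `z ∈ Z`
(`hτZ`), `ρ(ℓ) ∈ S` for `ℓ` real on `S` and zero on `Z` (`hρ`) — all three hold for `M₂(ℂ)`, `τ = tr`, `S` = Hermitian traceless, `Z = ℂ·1`; the `Z`-row of `M`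
cannot be dropped (`ℂ²`, `S = ℝ²`, `M = [[1,1],[0,0]]`).  The mechanism behind «`𝔇*(A′)H*` is real», (85)–(89). [cite: Balaban1985Variational, (85)–(90) p.291, (51) p.286] -/
theorem transCur_apply_mem [FiniteDimensional ℂ 𝔸] (S Z : Submodule ℝ 𝔸) (ρ : (𝔸 →L[ℂ] ℂ) →L[ℂ] 𝔸) (τ : 𝔸 →L[ℂ] ℂ)
    (hτS : ∀ X ∈ S, ∀ Y ∈ S, starRingEnd ℂ (τ (X * Y)) = τ (X * Y)) (hτZ : ∀ X ∈ S, ∀ z ∈ Z, τ (X * z) = 0)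
    (hρ : ∀ ℓ : 𝔸 →L[ℂ] ℂ, (∀ Y ∈ S, starRingEnd ℂ (ℓ Y) = ℓ Y) → (∀ z ∈ Z, ℓ z = 0) → ρ ℓ ∈ S)
    (M : Space115 L η lev₀ lev₁ Dc →L[ℂ] Space115 L η lev₀ lev₁ Dc)
    (hMS : ∀ Y : Space115 L η lev₀ lev₁ Dc, (∀ b, JetSup.equiv _ _ _ Y b ∈ S) → ∀ b, JetSup.equiv _ _ _ (M Y) b ∈ S)
    (hMZ : ∀ Y : Space115 L η lev₀ lev₁ Dc, (∀ b, JetSup.equiv _ _ _ Y b ∈ Z) → ∀ b, JetSup.equiv _ _ _ (M Y) b ∈ Z)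
    (K : NegSize L η lev₀ 3 𝔸) (hK : ∀ b, NegSup.equiv _ _ K b ∈ S) (b : Bond d Pd) :
    NegSup.equiv _ _ (transCur ρ τ M K) b ∈ S := by
  rw [transCur_apply]
  refine hρ _ (fun Y hY => ?_) (fun z hz => ?_)
  · rw [colFun_apply, map_sum]
    exact Finset.sum_congr rfl fun b' _ => hτS _ (hK b') _ (hMS _ (equiv_single115_mem S b hY) b')
  · rw [colFun_apply]
    exact Finset.sum_eq_zero fun b' _ => hτZ _ (hK b') _ (hMZ _ (equiv_single115_mem Z b hz) b')

/-- The real subspace of `S`-VALUED configurations of the space (115) is closed (finite-dimensional fibre) — membership is `∀ b, Y(b) ∈ S`.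
[cite: Balaban1985Variational, (115) p.294, (51) p.286] -/
theorem isClosed_setOf_equiv_mem [FiniteDimensional ℂ 𝔸] (S : Submodule ℝ 𝔸) :
    IsClosed {Y : Space115 L η lev₀ lev₁ Dc | ∀ b, JetSup.equiv _ _ _ Y b ∈ S} := by
  have h : {Y : Space115 L η lev₀ lev₁ Dc | ∀ b, JetSup.equiv _ _ _ Y b ∈ S} = ⋂ b, (fun Y => JetSup.evalCLM _ _ Dc b Y) ⁻¹' (S : Set 𝔸) := by
    ext Y; simp
  exact h ▸ isClosed_iInter fun b => S.closed_of_finiteDimensional.preimage (JetSup.evalCLM _ _ Dc b).continuous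

/-- The `S`-valued configurations as a real submodule of the space (115): the comap of `S^{bonds}` under the (real-linear) reading `flat115`;
membership unfolds to `∀ b, Y(b) ∈ S`. [cite: Balaban1985Variational, (115) p.294] -/
theorem mem_comap_flat115_pi_iff (S : Submodule ℝ 𝔸) (Y : Space115 L η lev₀ lev₁ Dc) :
    Y ∈ (Submodule.pi Set.univ fun _ : Bond d Pd => S).comap
        ((flat115 (L := L) (η := η) (lev₀ := lev₀) (lev₁ := lev₁) (Dc := Dc)).restrictScalars ℝ).toLinearMap ↔
      ∀ b, JetSup.equiv _ _ _ Y b ∈ S := by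
  simp [Submodule.mem_pi]

/-- ★ **§1 ON THE SPACE (115), POINTWISE FORM**: an analytic self-map `F` of the ball `B(0, r)` of (115) sending `S`-valued configurations to `S`-valued ones
has, at every `S`-valued `x` of the ball, a derivative sending `S`-valued `v` to `S`-valued `F′(x)v`. [cite: Balaban1985Variational, (51) p.286, (63) p.287] -/
theorem fderiv_apply_mem_of_analyticOnNhd [FiniteDimensional ℂ 𝔸] (S : Submodule ℝ 𝔸) {F : Space115 L η lev₀ lev₁ Dc → Space115 L η lev₀ lev₁ Dc} {r : ℝ}
    (hF : AnalyticOnNhd ℂ F (ball 0 r)) (hmaps : ∀ y, ‖y‖ < r → (∀ b, JetSup.equiv _ _ _ y b ∈ S) → ∀ b, JetSup.equiv _ _ _ (F y) b ∈ S)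
    {x : Space115 L η lev₀ lev₁ Dc} (hx : ‖x‖ < r) (hxS : ∀ b, JetSup.equiv _ _ _ x b ∈ S) {v : Space115 L η lev₀ lev₁ Dc}
    (hv : ∀ b, JetSup.equiv _ _ _ v b ∈ S) (b : Bond d Pd) : JetSup.equiv _ _ _ (fderiv ℂ F x v) b ∈ S := by
  let SY : Submodule ℝ (Space115 L η lev₀ lev₁ Dc) := (Submodule.pi Set.univ fun _ : Bond d Pd => S).comap
    ((flat115 (L := L) (η := η) (lev₀ := lev₀) (lev₁ := lev₁) (Dc := Dc)).restrictScalars ℝ).toLinearMap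
  have memSY : ∀ Y, Y ∈ SY ↔ ∀ b, JetSup.equiv _ _ _ Y b ∈ S := mem_comap_flat115_pi_iff S
  have hSYc : IsClosed (SY : Set (Space115 L η lev₀ lev₁ Dc)) := by
    have : (SY : Set (Space115 L η lev₀ lev₁ Dc)) = {Y | ∀ b, JetSup.equiv _ _ _ Y b ∈ S} := Set.ext fun Y => memSY Y
    rw [this]; exact isClosed_setOf_equiv_mem S
  have key := fderiv_apply_mem_of_mapsTo_of_mem (hF x (by simpa using hx)).differentiableAt.hasFDerivAt SY SY hSYc (ρ := r)
    (fun y hy hyρ => (memSY _).2 (hmaps y hyρ ((memSY y).1 hy))) ((memSY x).2 hxS) hx ((memSY v).2 hv)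
  exact (memSY _).1 key b

end Carriers

/-! ## §3 The chart `HD(·)` of (47), its second-order part and `HD₃`: sector rows -/

section Chart

variable {𝔸 : Type*} [NormedRing 𝔸] [NormedAlgebra ℂ 𝔸] [FiniteDimensional ℂ 𝔸]
variable {d : ℕ} {Pd : Fin d → ℕ} {L η : ℝ} [Fact (0 < L)] [Fact (0 < η)] {lev₀ : Bond d Pd → ℕ} {κ' : Type*} [Fintype κ']
  {lev₁ : κ' → ℕ} {Dc : (Bond d Pd → 𝔸) →ₗ[ℂ] (κ' → 𝔸)}
variable {𝒳 : Type*} [NormedAddCommGroup 𝒳] [NormedSpace ℂ 𝒳]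
variable {H : 𝒳 →L[ℂ] Space115 L η lev₀ lev₁ Dc} {C : Space115 L η lev₀ lev₁ Dc → 𝒳} {bH C₂ c₄ aC εC : ℝ}

/-- ★★ **`HD(A′)` IS `S`-VALUED FOR `S`-VALUED `A′`** (Sect. C regime; `C` maps `S`-valued fields of its ball into `S_𝒳`, `H` maps `S_𝒳` to `S`-valued fields):
the contraction (52) `X ↦ −H(C(X + A′))` preserves the closed set of `S`-valued configurations, so its unique fixed point `−HD(A′)` lies there
(lit ✓`B11Prop6Scheme.solution_mem_of_invariant`). [cite: Balaban1985Variational, (47)–(52) pp.285–286, (51) p.286] -/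
theorem Emap_apply_mem (RC : Regime H 0 C bH 0 C₂ c₄ 0 aC εC) (S : Submodule ℝ 𝔸) (S𝒳 : Submodule ℝ 𝒳)
    (hC : ∀ Y : Space115 L η lev₀ lev₁ Dc, ‖Y‖ < c₄ → (∀ b, JetSup.equiv _ _ _ Y b ∈ S) → C Y ∈ S𝒳)
    (hH : ∀ X ∈ S𝒳, ∀ b, JetSup.equiv _ _ _ (H X) b ∈ S)
    {A' : Space115 L η lev₀ lev₁ Dc} (hA' : ‖A'‖ < aC) (hA'S : ∀ b, JetSup.equiv _ _ _ A' b ∈ S) (b : Bond d Pd) :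
    JetSup.equiv _ _ _ (Emap H C εC A') b ∈ S := by
  obtain ⟨hXn, hfix⟩ := RC.solA_mem (J := (0 : 𝒳)) (by simp) hA'
  have hmem : solA H 0 C 0 εC A' ∈ {Y : Space115 L η lev₀ lev₁ Dc | ∀ b, JetSup.equiv _ _ _ Y b ∈ S} := by
    refine solution_mem_of_invariant RC.norm_G RC.norm_L RC.quad RC.B₀_nonneg RC.C₄_nonneg RC.θ_nonneg (by simp) hA' RC.ε₄_nonneg RC.dom
      RC.self RC.contr _ (isClosed_setOf_equiv_mem S) (fun b => by simp) (fun X hX hXε b => ?_) hXn hfix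
    rw [mapT_noLinear, map_zero, neg_zero, zero_sub]
    change -(JetSup.equiv _ _ _ (H (C (X + A'))) b) ∈ S
    have hn : ‖X + A'‖ < c₄ := by linarith [norm_add_le X A', RC.dom, RC.ε₄_nonneg, norm_nonneg A']
    refine S.neg_mem (hH _ (hC _ hn fun b' => ?_) b)
    rw [JetSup.equiv_add, Pi.add_apply]
    exact S.add_mem (hX b') (hA'S b')
  change -(JetSup.equiv _ _ _ (solA H 0 C 0 εC A') b) ∈ S
  exact S.neg_mem (hmem b)

/-- ★★ **`(HD)′(A′)Y` IS `S`-VALUED FOR `S`-VALUED `A′`, `Y`** (`‖A′‖ < a_C`): §1's first-order row at the point `A′` of the sector, `HD` being analytic on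
its ball (✓`analyticOnNhd_Emap`) and sector-preserving there (`Emap_apply_mem`). [cite: Balaban1985Variational, (51) p.286, (63) p.287, Prop. 3 p.289] -/
theorem fderiv_Emap_apply_mem (RC : Regime H 0 C bH 0 C₂ c₄ 0 aC εC) (hP4 : Prop4Hyp C C₂ c₄) (S : Submodule ℝ 𝔸) (S𝒳 : Submodule ℝ 𝒳)
    (hC : ∀ Y : Space115 L η lev₀ lev₁ Dc, ‖Y‖ < c₄ → (∀ b, JetSup.equiv _ _ _ Y b ∈ S) → C Y ∈ S𝒳)
    (hH : ∀ X ∈ S𝒳, ∀ b, JetSup.equiv _ _ _ (H X) b ∈ S)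
    {A' : Space115 L η lev₀ lev₁ Dc} (hA' : ‖A'‖ < aC) (hA'S : ∀ b, JetSup.equiv _ _ _ A' b ∈ S)
    {Y : Space115 L η lev₀ lev₁ Dc} (hY : ∀ b, JetSup.equiv _ _ _ Y b ∈ S) (b : Bond d Pd) :
    JetSup.equiv _ _ _ (fderiv ℂ (Emap H C εC) A' Y) b ∈ S :=
  fderiv_apply_mem_of_analyticOnNhd S (analyticOnNhd_Emap RC hP4) (fun _ hy hyS => Emap_apply_mem RC S S𝒳 hC hH hy hyS) hA' hA'S hY b

/-- ★ **THE SECOND-ORDER PART `C^{(2)}(Y)` IS IN `S_𝒳` FOR `S`-VALUED `Y`** (`C` analytic on its ball — Prop. 4's analyticity clause via Osgood — and mapping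
`S`-valued fields of the ball into the closed `S_𝒳`): §1's second-order diagonal row. [cite: Balaban1985Variational, (56) p.286, (78) p.290, (51) p.286] -/
theorem quadPart_mem [CompleteSpace 𝒳] (hP4 : Prop4Hyp C C₂ c₄) (hc₄ : 0 < c₄) (S : Submodule ℝ 𝔸) (S𝒳 : Submodule ℝ 𝒳) (hS𝒳 : IsClosed (S𝒳 : Set 𝒳))
    (hC : ∀ Y : Space115 L η lev₀ lev₁ Dc, ‖Y‖ < c₄ → (∀ b, JetSup.equiv _ _ _ Y b ∈ S) → C Y ∈ S𝒳)
    {Y : Space115 L η lev₀ lev₁ Dc} (hY : ∀ b, JetSup.equiv _ _ _ Y b ∈ S) : quadPart C Y ∈ S𝒳 := by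
  let SY : Submodule ℝ (Space115 L η lev₀ lev₁ Dc) := (Submodule.pi Set.univ fun _ : Bond d Pd => S).comap
    ((flat115 (L := L) (η := η) (lev₀ := lev₀) (lev₁ := lev₁) (Dc := Dc)).restrictScalars ℝ).toLinearMap
  have memSY : ∀ Y, Y ∈ SY ↔ ∀ b, JetSup.equiv _ _ _ Y b ∈ S := mem_comap_flat115_pi_iff S
  have hopen : IsOpen {Y : Space115 L η lev₀ lev₁ Dc | ‖Y‖ < c₄} := isOpen_lt continuous_norm continuous_const
  have hdiff : ∀ y : Space115 L η lev₀ lev₁ Dc, ‖y‖ < c₄ → DifferentiableAt ℂ C y := fun y hy =>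
    hP4.differentiableOn.differentiableAt (hopen.mem_nhds hy)
  have hA0 : AnalyticAt ℂ C 0 :=
    Literature.Analysis.Complex.SCV.analyticOnNhd_of_differentiableOn hP4.differentiableOn hopen 0 (by simpa using hc₄)
  have hdiff2 : DifferentiableAt ℂ (fderiv ℂ C) 0 :=
    ((hA0.contDiffAt (n := 2)).fderiv_right (m := 1) le_rfl).differentiableAt one_ne_zero
  have key : iteratedFDeriv ℂ 2 C 0 (fun _ => Y) ∈ S𝒳 :=
    iteratedFDeriv_two_apply_mem_of_mapsTo SY S𝒳 hS𝒳 hc₄ (fun y hy hyρ => hC y hyρ ((memSY y).1 hy)) hdiff hdiff2 ((memSY Y).2 hY)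
  have h2 : (2 : ℂ)⁻¹ • iteratedFDeriv ℂ 2 C 0 (fun _ => Y) = (2⁻¹ : ℝ) • iteratedFDeriv ℂ 2 C 0 (fun _ => Y) := by
    rw [← Complex.coe_smul]; norm_num
  unfold quadPart
  rw [h2]
  exact S𝒳.smul_mem _ key

/-- ★ **`HD₃(A′) = HD(A′) − HC^{(2)}(A′)` IS `S`-VALUED FOR `S`-VALUED `A′`** of the ball. [cite: Balaban1985Variational, (78) p.290, (51) p.286] -/
theorem E3_apply_mem [CompleteSpace 𝒳] (RC : Regime H 0 C bH 0 C₂ c₄ 0 aC εC) (hP4 : Prop4Hyp C C₂ c₄) (S : Submodule ℝ 𝔸) (S𝒳 : Submodule ℝ 𝒳)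
    (hS𝒳 : IsClosed (S𝒳 : Set 𝒳)) (hC : ∀ Y : Space115 L η lev₀ lev₁ Dc, ‖Y‖ < c₄ → (∀ b, JetSup.equiv _ _ _ Y b ∈ S) → C Y ∈ S𝒳)
    (hH : ∀ X ∈ S𝒳, ∀ b, JetSup.equiv _ _ _ (H X) b ∈ S)
    {A' : Space115 L η lev₀ lev₁ Dc} (hA' : ‖A'‖ < aC) (hA'S : ∀ b, JetSup.equiv _ _ _ A' b ∈ S) (b : Bond d Pd) :
    JetSup.equiv _ _ _ (E3 H C εC A') b ∈ S := by
  change JetSup.equiv _ _ _ (Emap H C εC A' - H (quadPart C A')) b ∈ S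
  rw [JetSup.equiv_sub, Pi.sub_apply]
  have hc₄ : 0 < c₄ := by linarith [RC.dom, RC.ε₄_nonneg, norm_nonneg A', hA']
  exact S.sub_mem (Emap_apply_mem RC S S𝒳 hC hH hA' hA'S b) (hH _ (quadPart_mem hP4 hc₄ S S𝒳 hS𝒳 hC hA'S) b)

/-- ★★ **`(HD₃)′(A′)Y` IS `S`-VALUED FOR `S`-VALUED `A′`, `Y`** (`‖A′‖ < a_C`): §1 at the point `A′`, `HD₃` analytic on the ball (✓`analyticOnNhd_E3`).
[cite: Balaban1985Variational, (78) p.290, (85) p.291, (51) p.286] -/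
theorem fderiv_E3_apply_mem [CompleteSpace 𝒳] (RC : Regime H 0 C bH 0 C₂ c₄ 0 aC εC) (hP4 : Prop4Hyp C C₂ c₄) (S : Submodule ℝ 𝔸)
    (S𝒳 : Submodule ℝ 𝒳) (hS𝒳 : IsClosed (S𝒳 : Set 𝒳))
    (hC : ∀ Y : Space115 L η lev₀ lev₁ Dc, ‖Y‖ < c₄ → (∀ b, JetSup.equiv _ _ _ Y b ∈ S) → C Y ∈ S𝒳)
    (hH : ∀ X ∈ S𝒳, ∀ b, JetSup.equiv _ _ _ (H X) b ∈ S)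
    {A' : Space115 L η lev₀ lev₁ Dc} (hA' : ‖A'‖ < aC) (hA'S : ∀ b, JetSup.equiv _ _ _ A' b ∈ S)
    {Y : Space115 L η lev₀ lev₁ Dc} (hY : ∀ b, JetSup.equiv _ _ _ Y b ∈ S) (b : Bond d Pd) :
    JetSup.equiv _ _ _ (fderiv ℂ (E3 H C εC) A' Y) b ∈ S :=
  fderiv_apply_mem_of_analyticOnNhd S (analyticOnNhd_E3 RC hP4) (fun _ hy hyS => E3_apply_mem RC hP4 S S𝒳 hS𝒳 hC hH hy hyS) hA' hA'S hY b

end Chart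

/-! ## §4 The rows (R-W₁), (R-W₂), (R-W₃), (R-W) in hypothesis form -/

section Rows

variable {𝔸 : Type*} [NormedRing 𝔸] [NormedAlgebra ℂ 𝔸] [FiniteDimensional ℂ 𝔸]
variable {d : ℕ} {Pd : Fin d → ℕ} {L η : ℝ} [Fact (0 < L)] [Fact (0 < η)] {lev₀ : Bond d Pd → ℕ} {κ' : Type*} [Fintype κ']
  {lev₁ : κ' → ℕ} {Dc : (Bond d Pd → 𝔸) →ₗ[ℂ] (κ' → 𝔸)}
variable {𝒳 : Type*} [NormedAddCommGroup 𝒳] [NormedSpace ℂ 𝒳]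
variable {H : 𝒳 →L[ℂ] Space115 L η lev₀ lev₁ Dc} {C : Space115 L η lev₀ lev₁ Dc → 𝒳} {bH C₂ c₄ aC εC : ℝ}
variable (RC : Regime H 0 C bH 0 C₂ c₄ 0 aC εC) (hP4 : Prop4Hyp C C₂ c₄)
  -- the real sector `S`, the scalar sector `Z` of the fibre algebra, and the sector `S_𝒳` of the `C`-letter's codomain
  (S Z : Submodule ℝ 𝔸) (S𝒳 : Submodule ℝ 𝒳)
  -- the letters of the pairing (27) and their duality rows
  (ρ : (𝔸 →L[ℂ] ℂ) →L[ℂ] 𝔸) (τ : 𝔸 →L[ℂ] ℂ)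
  (hτS : ∀ X ∈ S, ∀ Y ∈ S, starRingEnd ℂ (τ (X * Y)) = τ (X * Y)) (hτZ : ∀ X ∈ S, ∀ z ∈ Z, τ (X * z) = 0)
  (hρ : ∀ ℓ : 𝔸 →L[ℂ] ℂ, (∀ Y ∈ S, starRingEnd ℂ (ℓ Y) = ℓ Y) → (∀ z ∈ Z, ℓ z = 0) → ρ ℓ ∈ S)
  -- the sector rows of the letters `C` and `H`
  (hC : ∀ Y : Space115 L η lev₀ lev₁ Dc, ‖Y‖ < c₄ → (∀ b, JetSup.equiv _ _ _ Y b ∈ S) → C Y ∈ S𝒳)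
  (hH : ∀ X ∈ S𝒳, ∀ b, JetSup.equiv _ _ _ (H X) b ∈ S)

include RC hP4 hτS hτZ hρ hC hH

/-- ★ **(R-W₃): `W₃(A′) = 𝔇*(A′)H*Δ_π HD(A′)` IS `S`-VALUED FOR `S`-VALUED `A′`** (`‖A′‖ < a_C`), GIVEN the sector rows of `C`, `H`, `Δ_π` (`hC hH hΔπ`), the duality
rows of `(ρ, τ)` (§2) and the SCALAR-SECTOR row `hDZ` of `(HD)′(A′)`; the sector row of `(HD)′(A′)` is DERIVED (§3). [cite: Balaban1985Variational, (89) p.291, (51) p.286] -/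
theorem W3_apply_mem (Δπ : Space115 L η lev₀ lev₁ Dc →L[ℂ] NegSize L η lev₀ 3 𝔸)
    (hΔπ : ∀ Y : Space115 L η lev₀ lev₁ Dc, (∀ b, JetSup.equiv _ _ _ Y b ∈ S) → ∀ b, NegSup.equiv _ _ (Δπ Y) b ∈ S)
    {A' : Space115 L η lev₀ lev₁ Dc} (hA' : ‖A'‖ < aC) (hA'S : ∀ b, JetSup.equiv _ _ _ A' b ∈ S)
    (hDZ : ∀ z : Space115 L η lev₀ lev₁ Dc, (∀ b, JetSup.equiv _ _ _ z b ∈ Z) → ∀ b, JetSup.equiv _ _ _ (fderiv ℂ (Emap H C εC) A' z) b ∈ Z)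
    (b : Bond d Pd) : NegSup.equiv _ _ (W3 ρ τ H C εC Δπ A') b ∈ S :=
  transCur_apply_mem S Z ρ τ hτS hτZ hρ _ (fun _ hY b => fderiv_Emap_apply_mem RC hP4 S S𝒳 hC hH hA' hA'S hY b) hDZ _
    (hΔπ _ fun b => Emap_apply_mem RC S S𝒳 hC hH hA' hA'S b) b

/-- ★ **(R-W₂): `W₂(A′) = −(Δ_π HD(A′) + 𝔇*(A′)H*Δ_π A′)` IS `S`-VALUED FOR `S`-VALUED `A′`** (same letter rows as (R-W₃)).
[cite: Balaban1985Variational, (87)–(88) p.291, (51) p.286] -/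
theorem W2_apply_mem (Δπ : Space115 L η lev₀ lev₁ Dc →L[ℂ] NegSize L η lev₀ 3 𝔸)
    (hΔπ : ∀ Y : Space115 L η lev₀ lev₁ Dc, (∀ b, JetSup.equiv _ _ _ Y b ∈ S) → ∀ b, NegSup.equiv _ _ (Δπ Y) b ∈ S)
    {A' : Space115 L η lev₀ lev₁ Dc} (hA' : ‖A'‖ < aC) (hA'S : ∀ b, JetSup.equiv _ _ _ A' b ∈ S)
    (hDZ : ∀ z : Space115 L η lev₀ lev₁ Dc, (∀ b, JetSup.equiv _ _ _ z b ∈ Z) → ∀ b, JetSup.equiv _ _ _ (fderiv ℂ (Emap H C εC) A' z) b ∈ Z)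
    (b : Bond d Pd) : NegSup.equiv _ _ (W2 ρ τ H C εC Δπ A') b ∈ S := by
  change NegSup.equiv _ _ (-(Δπ (Emap H C εC A') + transCur ρ τ (fderiv ℂ (Emap H C εC) A') (Δπ A'))) b ∈ S
  rw [NegSup.equiv_neg, Pi.neg_apply, NegSup.equiv_add, Pi.add_apply]
  exact S.neg_mem (S.add_mem (hΔπ _ (fun b => Emap_apply_mem RC S S𝒳 hC hH hA' hA'S b) b)
    (transCur_apply_mem S Z ρ τ hτS hτZ hρ _ (fun _ hY b => fderiv_Emap_apply_mem RC hP4 S S𝒳 hC hH hA' hA'S hY b) hDZ _ (hΔπ _ hA'S) b))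

/-- ★ **(R-W₁): `W₁(A′) = −𝔇₃*(A′)H*J` IS `S`-VALUED FOR `S`-VALUED `A′`**, GIVEN additionally: `J` is `S`-valued (`hJ`), `S_𝒳` closed, and the scalar-sector
row `hD3Z` of `(HD₃)′(A′)`; the sector row of `(HD₃)′(A′)` is DERIVED (§3, second order included). [cite: Balaban1985Variational, (85) p.291, (78) p.290, (51) p.286] -/
theorem W1_apply_mem [CompleteSpace 𝒳] (hS𝒳 : IsClosed (S𝒳 : Set 𝒳)) (J : NegSize L η lev₀ 3 𝔸) (hJ : ∀ b, NegSup.equiv _ _ J b ∈ S)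
    {A' : Space115 L η lev₀ lev₁ Dc} (hA' : ‖A'‖ < aC) (hA'S : ∀ b, JetSup.equiv _ _ _ A' b ∈ S)
    (hD3Z : ∀ z : Space115 L η lev₀ lev₁ Dc, (∀ b, JetSup.equiv _ _ _ z b ∈ Z) → ∀ b, JetSup.equiv _ _ _ (fderiv ℂ (E3 H C εC) A' z) b ∈ Z)
    (b : Bond d Pd) : NegSup.equiv _ _ (W1 ρ τ H C εC J A') b ∈ S := by
  change NegSup.equiv _ _ (-transCur ρ τ (fderiv ℂ (E3 H C εC) A') J) b ∈ S
  rw [NegSup.equiv_neg, Pi.neg_apply]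
  exact S.neg_mem (transCur_apply_mem S Z ρ τ hτS hτZ hρ _ (fun _ hY b => fderiv_E3_apply_mem RC hP4 S S𝒳 hS𝒳 hC hH hA' hA'S hY b) hD3Z _ hJ b)

/-- ★★ **(R-W): THE CURRENT `W(A′) = W₁ + W₂ + W₃ + (V₀-GROUP)` OF (84) IS `S`-VALUED FOR `S`-VALUED `A′`** (`‖A′‖ < a_C`) — cell `ym3-torus`'s knit row `hWR` for the
concrete letter `W80`, IN HYPOTHESIS FORM: sector rows of `C`, `H`, `J`, `Δ_π`, duality rows of `(ρ, τ)`, scalar-sector rows `hDZ`/`hD3Z`, and the row `hV0` of the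
composed V₀-group current (90)–(96) at `A′` (`B11Eq90V0GroupComposed.curV0full`, its own storey). [cite: Balaban1985Variational, (84) p.290, (85)–(89) p.291, (51) p.286] -/
theorem W80_apply_mem [CompleteSpace 𝔸] [CompleteSpace 𝒳] (hS𝒳 : IsClosed (S𝒳 : Set 𝒳)) (U₀ : Bond d Pd → 𝔸ˣ) (J : NegSize L η lev₀ 3 𝔸)
    (hJ : ∀ b, NegSup.equiv _ _ J b ∈ S) (Δπ : Space115 L η lev₀ lev₁ Dc →L[ℂ] NegSize L η lev₀ 3 𝔸)
    (hΔπ : ∀ Y : Space115 L η lev₀ lev₁ Dc, (∀ b, JetSup.equiv _ _ _ Y b ∈ S) → ∀ b, NegSup.equiv _ _ (Δπ Y) b ∈ S)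
    {A' : Space115 L η lev₀ lev₁ Dc} (hA' : ‖A'‖ < aC) (hA'S : ∀ b, JetSup.equiv _ _ _ A' b ∈ S)
    (hDZ : ∀ z : Space115 L η lev₀ lev₁ Dc, (∀ b, JetSup.equiv _ _ _ z b ∈ Z) → ∀ b, JetSup.equiv _ _ _ (fderiv ℂ (Emap H C εC) A' z) b ∈ Z)
    (hD3Z : ∀ z : Space115 L η lev₀ lev₁ Dc, (∀ b, JetSup.equiv _ _ _ z b ∈ Z) → ∀ b, JetSup.equiv _ _ _ (fderiv ℂ (E3 H C εC) A' z) b ∈ Z)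
    (hV0 : ∀ b, NegSup.equiv _ _ (curV0full ρ τ U₀ H C εC A') b ∈ S)
    (b : Bond d Pd) : NegSup.equiv _ _ (W80 ρ τ U₀ H C εC J Δπ A') b ∈ S := by
  change NegSup.equiv _ _ (W1 ρ τ H C εC J A' + W2 ρ τ H C εC Δπ A' + W3 ρ τ H C εC Δπ A' + curV0full ρ τ U₀ H C εC A') b ∈ S
  rw [NegSup.equiv_add, Pi.add_apply, NegSup.equiv_add, Pi.add_apply, NegSup.equiv_add, Pi.add_apply]
  exact S.add_mem (S.add_mem (S.add_mem (W1_apply_mem RC hP4 S Z S𝒳 ρ τ hτS hτZ hρ hC hH hS𝒳 J hJ hA' hA'S hD3Z b)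
    (W2_apply_mem RC hP4 S Z S𝒳 ρ τ hτS hτZ hρ hC hH Δπ hΔπ hA' hA'S hDZ b)) (W3_apply_mem RC hP4 S Z S𝒳 ρ τ hτS hτZ hρ hC hH Δπ hΔπ hA' hA'S hDZ b)) (hV0 b)

end Rows

end Literature.MathematicalPhysics.QuantumFieldTheory.Balaban1983to89.B11Eq80CurrentRealSubspace

end
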